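import Literature.Probability.RandomPlanarGeometry.SchwarzianCapacity
import Literature.Probability.RandomPlanarGeometry.SLEBubblesSchwarzianMass
import HarnessLib

/-!
# `−SΦ_B(0)/6 ≥ 0`, `> 0` and monotone on `𝒬*`; the hitting masses (7.2) as real numbers ([LSW] (5.1) for `*`-hulls)

Proof-only file (no definition, no named fact), corollaries of `SchwarzianCapacity` ([LSW] (5.1):
`−SΦ(0)/6 = hcap` of the inverted hull) for the canonical jets of `*`-hulls
(`SLEBubblesSchwarzianMass`: `starBubbleMass B = −SE_B(0)/6`, `hasRestrictionJet_starRMap`), after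

* G. F. Lawler, O. Schramm, W. Werner, *Conformal restriction: the chordal case*, J. Amer. Math.
  Soc. **16** (2003) 917–955, arXiv:math/0209343 (**[LSW]**), §5 eq. (5.1) with "Consequently,
  `Sg_A ≤ 0` on `ℝ ∖ A`", Prop. 5.3 ("The bound on `Y_t` follows from `Sh_t(W_t) ≤ 0`"), §7.1 (7.2);
* G. F. Lawler, *Conformally Invariant Processes in the Plane*, AMS (2005), §3.4 (3.8)–(3.10)
  (`hcap > 0`, additivity and monotonicity of `hcap`).

Contents (all PROVED):

* `starBubbleMass_eq_hcap` — (5.1) for `Φ_B`: `starBubbleMass B = hcap (invHull B) ψ_B`;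
* `starBubbleMass_nonneg`, `starBubbleMass_pos` (nonempty `*`-hulls);
* `starBubbleMass_mono` — `A ⊆ B` in `𝒬*` ⇒ `−SΦ_A(0)/6 ≤ −SΦ_B(0)/6` (additivity of `hcap`
  under composition, `IsHydrodynamicMap.hcap_diffQuotient`, on the nested inverted hulls);
* `IsBrownianBubbleMeasure.measure_hit_toReal` (`(μ{K ∩ B ≠ ∅}).toReal = starBubbleMass B`) and
  `IsBrownianBubbleMeasure.measure_hit_mono`.

These are the sign and monotonicity inputs of [LSW] Prop. 5.3 / Thm. 6.5 (`0 ≤ Y_t ≤ 1`) and of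
the passage from smooth hulls to `𝒬*` in the proof of Thm. 6.5, for the Schwarzian functional
`starBubbleMass (A_t − W_t)` of `SLEBubbles.lintegral_poissonAvoidance_eq_rpow_of_thm65`.

## References

* [LSW] §5 eq. (5.1); Prop. 5.3; §7.1 (7.2). [LawlerSchrammWerner2003Restriction]
* Lawler (2005), §3.4 (3.8)–(3.10). [Lawler2005]
-/

noncomputable section

open Set Filter Topology Metric Complex Bornology
open UpperHalfPlane (upperHalfPlaneSet isOpen_upperHalfPlaneSet)
open scoped NNReal ENNReal

namespace Literature.Probability.RandomPlanarGeometry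

open Loewner

/-! ### `*`-hulls: sign, positivity and monotonicity of `−SΦ_B(0)/6` -/

section Star

variable {A B : Set ℂ}

/-- A `*`-hull is off some ball `B(0, δ)`. [folklore] -/
theorem IsStarHull.exists_pos_disjoint_ball (h : IsStarHull B) :
    ∃ δ : ℝ, 0 < δ ∧ Disjoint (ball (0 : ℂ) δ) B := by
  obtain ⟨r, hr0, hr⟩ := h.exists_disjoint_ball
  exact ⟨2 * r, by positivity, hr⟩

/-- **(5.1) for the canonical map of a `*`-hull**: `−SΦ_B(0)/6 = starBubbleMass B` is the
half-plane capacity of the inverted hull `invHull B`.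
[cite: LawlerSchrammWerner2003Restriction, §5 eq. (5.1)] -/
theorem starBubbleMass_eq_hcap (h : IsStarHull B) {δ : ℝ} (hδ : 0 < δ) (hBδ : Disjoint (ball (0 : ℂ) δ) B) :
    starBubbleMass B =
      hcap (invHull B) (invertedMap (starRMap B h) (starDeriv B) (starDeriv_spec h).1 (starJet2 B / 2 / starDeriv B)) := by
  rw [starBubbleMass, ← (hasRestrictionJet_starRMap h).hcap_invertedMap (starDeriv_spec h).1 hδ hBδ]

/-- **`−SΦ_B(0)/6 ≥ 0` for every `*`-hull** ([LSW] §5, "`Sg_A ≤ 0`"; the sign behind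
`0 ≤ Y_t ≤ 1` in Prop. 5.3). [cite: LawlerSchrammWerner2003Restriction, §5 (after (5.1)) and Prop. 5.3] -/
theorem starBubbleMass_nonneg (h : IsStarHull B) : 0 ≤ starBubbleMass B := by
  obtain ⟨δ, hδ, hBδ⟩ := h.exists_pos_disjoint_ball
  exact (hasRestrictionJet_starRMap h).bubbleMass_nonneg (starDeriv_spec h).1 hδ hBδ

/-- A nonempty bounded hull meets `ℍ` (`A = cl(A ∩ ℍ)`). [folklore] -/
theorem IsBoundedHull.inter_nonempty (h : IsBoundedHull B) (hne : B.Nonempty) :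
    (B ∩ upperHalfPlaneSet).Nonempty := by
  by_contra hem
  rw [not_nonempty_iff_eq_empty] at hem
  have : B = ∅ := by rw [← h.closure_inter_eq, hem, closure_empty]
  exact hne.ne_empty this

/-- **`−SΦ_B(0)/6 > 0` for every nonempty `*`-hull.** [cite: Lawler2005, §3.4 (3.8)] -/
theorem starBubbleMass_pos (h : IsStarHull B) (hne : B.Nonempty) : 0 < starBubbleMass B := by
  obtain ⟨δ, hδ, hBδ⟩ := h.exists_pos_disjoint_ball
  exact (hasRestrictionJet_starRMap h).bubbleMass_pos (starDeriv_spec h).1 hδ hBδ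
    (h.isBoundedHull.inter_nonempty hne)

/-- **Monotonicity: `A ⊆ B` in `𝒬*` implies `−SΦ_A(0)/6 ≤ −SΦ_B(0)/6`** — the inverted hulls are
nested, and the half-plane capacity is additive, hence monotone, under the composition
`ψ_B = (ψ_B ∘ ψ_A⁻¹) ∘ ψ_A` (`IsHydrodynamicMap.hcap_diffQuotient`, Lawler (3.8)/(3.10)).
[cite: Lawler2005, §3.4 (3.10)] -/
theorem starBubbleMass_mono (hA : IsStarHull A) (hB : IsStarHull B) (hAB : A ⊆ B) :
    starBubbleMass A ≤ starBubbleMass B := by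
  obtain ⟨δ, hδ, hBδ⟩ := hB.exists_pos_disjoint_ball
  have hAδ : Disjoint (ball (0 : ℂ) δ) A := hBδ.mono_right hAB
  rw [starBubbleMass_eq_hcap hA hδ hAδ, starBubbleMass_eq_hcap hB hδ hBδ]
  set ψA := invertedMap (starRMap A hA) (starDeriv A) (starDeriv_spec hA).1 (starJet2 A / 2 / starDeriv A)
    with hψA
  set ψB := invertedMap (starRMap B hB) (starDeriv B) (starDeriv_spec hB).1 (starJet2 B / 2 / starDeriv B)
    with hψB
  have h₁ : IsHydrodynamicMap (invHull A) ψA :=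
    (hasRestrictionJet_starRMap hA).isHydrodynamicMap_invertedMap (starDeriv_spec hA).1
  have h₂ : IsHydrodynamicMap (invHull B) ψB :=
    (hasRestrictionJet_starRMap hB).isHydrodynamicMap_invertedMap (starDeriv_spec hB).1
  have hb₁ := isBounded_invHull_inter hδ hAδ
  have hb₂ := isBounded_invHull_inter hδ hBδ
  have h12 : upperHalfPlaneSet \ invHull B ⊆ upperHalfPlaneSet \ invHull A :=
    sdiff_subset_sdiff_right (invHull_mono hAB)
  have hq := h₁.hcap_diffQuotient h₂ hb₁ hb₂ h12
  have hq0 : 0 ≤ hcap (diffImage ψA (invHull B)) (diffQuotient ψA ψB h12) :=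
    (h₁.diffQuotient h₂ hb₁ h12).hcap_nonneg (h₁.isBounded_diffImage hb₁ hb₂)
  linarith

/-- **The hitting mass of a `*`-hull under a Brownian bubble measure, as a real number**:
`(μ{K ∩ B ≠ ∅}).toReal = −SΦ_B(0)/6` (the mass is finite and the Schwarzian term nonnegative).
[cite: LawlerSchrammWerner2003Restriction, §7.1 eq. (7.2) with §5 (5.1)] -/
theorem IsBrownianBubbleMeasure.measure_hit_toReal {μ : MeasureTheory.Measure BubbleConfig}
    (hμ : IsBrownianBubbleMeasure μ) (h : IsStarHull B) :
    (μ (BubbleConfig.hit B)).toReal = starBubbleMass B := by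
  rw [hμ.measure_hit_eq_starBubbleMass h, ENNReal.toReal_ofReal (starBubbleMass_nonneg h)]

/-- **Monotonicity of the hitting masses in the hull** (obvious for a measure, `hit A ⊆ hit B`;
recorded next to the analytic `starBubbleMass_mono`, which it re-proves for hulls hit by some
Brownian bubble measure). [folklore] -/
theorem IsBrownianBubbleMeasure.measure_hit_mono {μ : MeasureTheory.Measure BubbleConfig}
    (hAB : A ⊆ B) : μ (BubbleConfig.hit A) ≤ μ (BubbleConfig.hit B) :=
  MeasureTheory.measure_mono fun _ hK hdis ↦ hK (hdis.mono_right hAB)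

end Star

end Literature.Probability.RandomPlanarGeometry

end
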